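import Literature.IUT.LogThetaLattice.TensorPacketsGaloisAction
import Literature.IUT.LogThetaLattice.GlobalPacketsDecompositionUnique
import HarnessLib

/-!
# [IUTchIII] Proposition 3.1 (i): the direct-sum-of-fields decomposition of the tensor packet is "uniquely
# determined by the ring structure" and "compatible with the natural action of `^αΠ_v`" — PROVED at the typed level

S. Mochizuki, *Inter-universal Teichmüller theory III*, kurims manuscript (May 2020) `paper:url-4b091feeb646`, §3,
Proposition 3.1 (i) "(Ring Structures)", p. 93 l. 4–14: "`log(^A𝓕_{v_ℚ})` may be regarded as an inductive limit of direct
sums of ind-topological fields … Such decompositions as direct sums of ind-topological fields are uniquely determined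
by the ind-topological ring structure of `log(^A𝓕_{v_ℚ})` and, moreover, are compatible, for `α ∈ A`, with the natural
action of the topological group `^αΠ_v` [… on the direct summand with subscript `v` of the factor labeled `α`]"
[claim: Mochizuki2012, status: disputed]; abc-iut cell, layer L6, seat abc-iut-L6-t4 (typer of record of [IUTchIII] §3;
gen 4). PROOF-ONLY companion (no `def`): abc-iut-L6-t4's `TensorPackets.lean` (p403825) types the first clause as
`Prop31i_ringStructures` (an abstract `PacketN 𝕜 L ≃+* ∏_i K_i`; DISCHARGED at the locally-étale model, p408566) and
records the two further clauses as "automatic for a reduced artinian ring" / "not modelled: group actions";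
`TensorPacketsGaloisAction.lean` (p425493) supplies the natural action `packetNAut 𝕜 L` of `^AΠ_{v_ℚ}`; abc-iut-w5-d154's
`GlobalPacketsDecompositionUnique.lean` PROVES the classical structure lemma `ringEquiv_pi_field_unique` (two
decompositions of one commutative ring as finite products of fields differ by a bijection of the index sets and
projection-compatible field isomorphisms; [cite: AtiyahMacdonald1969, Thm 8.7 (uniqueness)]) for [IUTchIII] Prop. 3.3
(i)'s "uniquely". Here both remaining clauses of Prop. 3.1 (i) are DERIVED from that lemma BY NAME:

* `prop31i_decomposition_unique` — "uniquely determined by the ring structure of `log(^A𝓕_{v_ℚ})`" for the LOCAL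
  `n`-tensor packet `PacketN 𝕜 L`;
* `prop31i_compatible_ringAut` — for ANY ring automorphism `σ` of a ring `P` with a decomposition `e : P ≃+* ∏_i K_i`,
  `σ` read through `e` PERMUTES the direct summand fields and acts on them by field isomorphisms;
* **`prop31i_compatible_packetNAut`** — "compatible … with the natural action of `^αΠ_v`": the automorphisms
  `packetNAut 𝕜 L σ` (each `^αΠ` acting on its factor `log(^α𝓕_{v_ℚ})`) permute the direct summand fields of any
  decomposition of `log(^A𝓕_{v_ℚ})` and induce field isomorphisms between them; `prop31ii_compatible_packetAtAut` — the
  same for `log(^{A,α}𝓕_v)` under `packetAtAut` (Prop. 3.1 (ii) / 3.4 (i)).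

HONEST SCOPE: one finite level (no inductive limit / ind-topology), continuity not asserted; nothing here asserts abc
proved or refuted or takes a side on [IUTchIII] Cor. 3.12; typed ≠ discharged.
-/

noncomputable section

namespace Literature.IUT.LogThetaLattice

universe u u' v v' w w₁ w₂

section Prop31i

variable {ι : Type u} {κ : Type u'} [Finite ι] [Finite κ]
variable {K : ι → Type w₁} [∀ i, Field (K i)] {K' : κ → Type w₂} [∀ k, Field (K' k)]

omit [Finite κ] in
/-- **[IUTchIII] Prop. 3.1 (i) "… compatible …"**, ring-theoretic core: for any decomposition `e : P ≃+* ∏_i K_i` of a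
commutative ring as a finite product of fields and ANY ring automorphism `σ` of `P`, there are a permutation `π` of
the index set and field isomorphisms `g_i : K_i ≃+* K_{π i}` with `g_i((e p)_i) = (e (σ p))_{π i}` — `σ` permutes the
direct summands and acts on them by field isomorphisms (abc-iut-w5-d154's `ringEquiv_pi_field_unique` applied to the
two decompositions `e` and `σ ≫ e`). [cite: Mochizuki2012, Prop. 3.1 (i) p.93] [claim: Mochizuki2012, status: disputed] -/
theorem prop31i_compatible_ringAut {P : Type v} [CommRing P] (e : P ≃+* ∀ i, K i) (σ : P ≃+* P) :
    ∃ π : ι ≃ ι, ∀ i, ∃ g : K i ≃+* K (π i), ∀ p : P, g (e p i) = e (σ p) (π i) :=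
  ringEquiv_pi_field_unique e (σ.trans e)

variable (𝕜 : Type u) [Field 𝕜] {A : Type v} {Vfib : Type v'}
variable (L : A → Vfib → Type w) [∀ α v, CommRing (L α v)] [∀ α v, Algebra 𝕜 (L α v)]

/-- **[IUTchIII] Prop. 3.1 (i) p. 93 "Such decompositions as direct sums of … fields are uniquely determined by the … ring
structure of `log(^A𝓕_{v_ℚ})`"** — for the local `n`-tensor packet `log(^A𝓕_{v_ℚ}) = PacketN 𝕜 L` (abc-iut-L6-t4): any two
decompositions `e : PacketN 𝕜 L ≃+* ∏_ι K_i`, `f : PacketN 𝕜 L ≃+* ∏_κ K'_k` as finite products of fields (the data of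
`Prop31i_ringStructures`) differ by a bijection `ι ≃ κ` and projection-compatible field isomorphisms — abc-iut-w5-d154's
`ringEquiv_pi_field_unique` BY NAME (stated there for the global packet of Prop. 3.3 (i)).
[cite: Mochizuki2012, Prop. 3.1 (i) p.93] [claim: Mochizuki2012, status: disputed] -/
theorem prop31i_decomposition_unique (e : PacketN 𝕜 L ≃+* ∀ i, K i) (f : PacketN 𝕜 L ≃+* ∀ k, K' k) :
    ∃ π : ι ≃ κ, ∀ i, ∃ g : K i ≃+* K' (π i), ∀ t : PacketN 𝕜 L, g (e t i) = f t (π i) :=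
  ringEquiv_pi_field_unique e f

omit [Finite κ] in
/-- **[IUTchIII] Prop. 3.1 (i) p. 93 "… and, moreover, are compatible, for `α ∈ A`, with the natural action of the topological
group `^αΠ_v`"** — PROVED at the typed level: for every decomposition `e : log(^A𝓕_{v_ℚ}) ≃+* ∏_i K_i` as a finite
product of fields and every element `σ = (σ_α)_α` of `^AΠ_{v_ℚ} = ∏_α ^αΠ` acting through `packetNAut 𝕜 L` (p425493), the
automorphism `packetNAut 𝕜 L σ` PERMUTES the direct summand fields (`π`) and induces field isomorphisms
`g_i : K_i ≃+* K_{π i}` with `g_i((e t)_i) = (e (σ·t))_{π i}`. [cite: Mochizuki2012, Prop. 3.1 (i) p.93]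
[claim: Mochizuki2012, status: disputed] -/
theorem prop31i_compatible_packetNAut (e : PacketN 𝕜 L ≃+* ∀ i, K i)
    (σ : ∀ α, (Packet1 L α ≃ₐ[𝕜] Packet1 L α)) :
    ∃ π : ι ≃ ι, ∀ i, ∃ g : K i ≃+* K (π i),
      ∀ t : PacketN 𝕜 L, g (e t i) = e (packetNAut 𝕜 L σ t) (π i) :=
  prop31i_compatible_ringAut (P := PacketN 𝕜 L) e (packetNAut 𝕜 L σ).toRingEquiv

omit [Finite κ] in
/-- The same for an automorphism of the factor `α` (and of the others) acting on `log(^{A,α}𝓕_v)` through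
`packetAtAut 𝕜 L α v (σ, τ)` (Prop. 3.1 (ii); Prop. 3.4 (i)'s "`^αΠ_v`-action"), for any decomposition of
`log(^{A,α}𝓕_v)` as a finite product of fields (the analogue of `Prop31i_ringStructures` for `log(^{A,α}𝓕_v)` recorded in
the docstring of `Prop31ii_directSummand`). [cite: Mochizuki2012, Prop. 3.1 (ii) p.93] [claim: Mochizuki2012, status: disputed] -/
theorem prop31ii_compatible_packetAtAut (α : A) (v : Vfib) (e : PacketAt 𝕜 L α v ≃+* ∀ i, K i)
    (στ : (L α v ≃ₐ[𝕜] L α v) × (∀ β : {β : A // β ≠ α}, (Packet1 L β.1 ≃ₐ[𝕜] Packet1 L β.1))) :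
    ∃ π : ι ≃ ι, ∀ i, ∃ g : K i ≃+* K (π i),
      ∀ t : PacketAt 𝕜 L α v, g (e t i) = e (packetAtAut 𝕜 L α v στ t) (π i) :=
  prop31i_compatible_ringAut (P := PacketAt 𝕜 L α v) e (packetAtAut 𝕜 L α v στ).toRingEquiv

end Prop31i

end Literature.IUT.LogThetaLattice

end
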